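import Literature.MathematicalPhysics.QuantumFieldTheory.Dimock2011to13.QED3LargeFieldFermionIntegration
import Literature.MathematicalPhysics.QuantumFieldTheory.Dimock2011to13.QED3TwoSpeciesGaussianDictionary
import HarnessLib

/-!
# Dimock, *Ultraviolet stability for QED in d = 3*, §4.2.1 LEMMA 20 (449): the integration step (452)∕(455) and the last
# Gaussian estimate (457) for Dimock's ACTUAL unit Gaussian `dμ_I` — «`|∫f(Ψ)dμ_I(Ψ)| ≤ ‖f‖₁`» PROVED for `dμ_I`, the
# hypothesis `hμ` of `lemma20_step(_printed)` DISCHARGED, and (457) `|∫F₀ DΨ₀| ≤ e^{|δΩ₀^{(0)}|}‖F₀‖₁` PROVED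

statement-level skeleton of published theorems with citation tags; proofs where landed; nothing here is a claim about the Yang–Mills mass gap

**Citation header (reproduction of PUBLISHED work).** J. Dimock, *Ultraviolet stability for QED in d = 3*, Ann. Henri
Poincaré **23** (2022) 2113–2205 (= arXiv:2009.01156v2) [Dimock2022UVStabilityQED3], §4.2.1 LEMMA 20 (449) p.60 L96–107,
proof (451)–(452) p.61 L30–67, (455)–(457) p.62 L1–38 — loci of the held arXiv text layer `paper:arxiv-2009.01156`.
J. Dimock, *Quantum electrodynamics on the 3-torus. I*, arXiv:math-ph/0210020 [Dimock2002QED3TorusI], App. B (299) p.62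
L9–13 (the norm `‖F‖_h`), LEMMA 21 (311) p.64 L1–12.  Writer seat p11 (literature-prover-lit-balaban-p11-g27-0), YM LIT
SWEEP item (c) D8 (row C08; zero weight for the YM-INPRINT tokens).  CAPSTONE of the tree's
`QED3LargeFieldFermionIntegration` (`lemma20_step`, `lemma20_step_printed`, `lemma20_assembled` — there with the measure
an abstract functional `μ` obeying `|μ(θ′_T)| ≤ 1` and (457) a hypothesis `h457`), `QED3TwoSpeciesGaussianDictionary`
(`unitGaussian_hμ_twoSpeciesCov_one`: `|∫θ_S dμ_I| ≤ 1` for `dμ_I = gaussExpect 𝕜 (twoSpeciesCov 𝕜 1)`) and the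
`QuantumLattice.GrassmannBerezinLaplacianBridge` (`berezin_eq_det_mul_gaussExpect_unit`: (451)
`∫dΨ̄dΨ F = ±∫e^{⟨Ψ̄,Ψ⟩}F dμ_I`).

**The printed text (verbatim, text layer).**  p.61 L30–52: *"To facilitate estimates we artificially introduce a
Gaussian integral by `DΨ′_{K,Ω_K} = e^{⟨Ψ̄′_K,Ψ′_K⟩_{Ω_K}}dμ_I(Ψ′_K)` … (451) … In general on a unit lattice
`|∫f(Ψ)dμ_I(Ψ)| ≤ ‖f‖₁`, see the appendix in [30]. So with `I_K = (L^K,…,1)` we have `(LI_{K−1},1) = I_K` and hence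
`‖F_{K−1}‖_{I_{K−1},LI_{K−1}} ≤ L^{|Ω_K^{(K)}|}‖F′_{K,L}exp(⟨Ψ̄′_K,Ψ′_K⟩_{Ω_K})‖_{I_{K−1},1,LI_{K−1},1} ≤
L^{|Ω_K^{(K)}|}‖F′_{K,L}‖_{I_{K−1},1,LI_{K−1},1}exp(‖⟨Ψ̄′_K,Ψ′_K⟩_{Ω_K}‖₁) ≤ L^{|Ω_K^{(K)}|}‖F_K‖_{LI_{K−1},1,LI_{K−1},1}
exp(|Ω_K^{(K)}|)` (452)"*.  p.62 L31–38: *"The representation of `J_{K,Π}` in terms of `F_{0,Π}` is `J_{K,Π} =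
∫F_0(Ψ_{0,L^KΩ^c_1})DΨ_{0,L^KΩ^c_1}` (457) This is also estimated as a Gaussian integral which gives an additional factor
`e^{|L^KΩ^c_1|} = e^{|Ω^c_1|} ≡ e^{|δΩ_0^{(0)}|}`. This completes the proof."*

**What is formalized (kernel-checked, zero `sorry`, no named facts).**  Generators `X ⊕ₗ X` = the letters `Ψ̄_x`
(`inl x`), `Ψ_x` (`inr x`) of a region with `|X|` sites; `dμ_I := gaussExpect 𝕜 (twoSpeciesCov 𝕜 1)`; `‖·‖₁ = hNorm 1`
(paper I (299) with `h = 1`); `∫·DΨ = berezin 𝕜 (X ⊕ₗ X)` (the product Grassmann integral).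
* §1 «in general `|∫f dμ| ≤ ‖f‖₁`»: `norm_apply_le_hNorm_one` — ANY linear functional with `|μ(θ_T)| ≤ 1` on the
  monomials obeys `|μ(f)| ≤ ‖f‖₁` (expand in the monomial basis); `norm_berezin_le_hNorm_one` — for `∫·DΨ` itself
  (`|∫f DΨ|` = the top coefficient `≤ ‖f‖₁`, the tree's normalisation; sharper than (457) but not the printed route).
* §2 **`|∫f dμ_I| ≤ ‖f‖₁` for Dimock's `dμ_I`**: `norm_unitGaussExpect_le_hNorm_one`; with the normalizing factor,
  `norm_unitGaussExpect_grassmannExp_quadratic_mul_le` — `|∫e^{⟨Ψ̄,Ψ⟩}f dμ_I| ≤ e^{|X|}‖f‖₁` (LEMMA 19 of paper I,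
  `‖e^{Q}‖₁ ≤ e^{‖Q‖₁}`, `‖⟨Ψ̄,Ψ⟩_X‖₁ ≤ |X|`).
* §3 **(457) PROVED**: `eq457` — `|∫F₀ DΨ₀| ≤ e^{|X|}‖F₀‖₁` ((451) for the unit covariance, then §2); and
  **`lemma20_assembled_unit`** — LEMMA 20 (449) `|J_{K,Π}| ≤ e^{|δΩ₀^{(0)}| + S₁ + S₂}` with `J_{K,Π} = ∫F₀DΨ₀` and (457) no
  longer a hypothesis ((456) `‖F₀‖₁ ≤ e^{S₁}a_K` and LEMMA 19's (435) `a_K ≤ e^{S₂}` remain the inputs, as in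
  `lemma20_assembled`).
* §4 **the step for `dμ_I`**: `lemma20_step_unit`, **`lemma20_step_printed_unit`** — `lemma20_step(_printed)` with
  `μ = dμ_I` and NO hypothesis on the measure: `‖L^{|X|}∫F′_L e^{−⟨Ψ̄′,Ψ′⟩}dμ_I(Ψ′)‖_{w′} ≤ e^{(1+log L)|X|}‖F‖_{(Lw,1)}`.

**Honest scope.**  Finite Grassmann algebra over `𝕜 = ℝ, ℂ`; the regions, the recursion (450) and LEMMAS 18–19 are not
constructed (they stay the inputs `h456`, `h435` and the label types, exactly as in `QED3LargeFieldFermionIntegration`).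
No `d = 4` statement; nothing about Bałaban's papers.
-/

noncomputable section

open Finset

namespace Literature.MathematicalPhysics.QuantumFieldTheory.Dimock2011to13

namespace QED3LargeFieldFermion

open Literature.MathematicalPhysics.QuantumLattice
open Literature.MathematicalPhysics.QuantumLattice.GrassmannAlgebra
open QED3TorusI

variable {𝕜 : Type*} [RCLike 𝕜]

/-! ## §1 «In general `|∫f(Ψ)dμ(Ψ)| ≤ ‖f‖₁`» for a functional bounded by `1` on the monomials -/

section UnitBound

variable {ι : Type*} [LinearOrder ι] [Fintype ι]

/-- «In general on a unit lattice `|∫f(Ψ)dμ_I(Ψ)| ≤ ‖f‖₁`», abstract form: a linear functional `μ` with `|μ(θ_T)| ≤ 1`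
on every monomial satisfies `|μ(f)| ≤ ‖f‖₁ = Σ_T|c_T(f)|` (expand `f = Σ_T c_T(f)θ_T`).
[cite: Dimock2022UVStabilityQED3, §4.2.1 Lemma 20 proof (452) p.61 L45–47; Dimock2002QED3TorusI, App. B (299) p.62 L9–13] -/
theorem norm_apply_le_hNorm_one (μ : GrassmannAlgebra 𝕜 ι →ₗ[𝕜] 𝕜)
    (hμ : ∀ T : Finset ι, ‖μ (grassmannBasis 𝕜 ι T)‖ ≤ 1) (F : GrassmannAlgebra 𝕜 ι) :
    ‖μ F‖ ≤ hNorm 1 F := by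
  have hF : F = ∑ S, coeff F S • grassmannBasis 𝕜 ι S := ((grassmannBasis 𝕜 ι).sum_repr F).symm
  conv_lhs => rw [hF]
  rw [map_sum, hNorm_def]
  refine (norm_sum_le _ _).trans (Finset.sum_le_sum fun S _ => ?_)
  rw [map_smul, smul_eq_mul, norm_mul, one_pow, one_mul]
  exact mul_le_of_le_one_right (norm_nonneg _) (hμ S)

/-- The product Grassmann integral `∫·DΨ` (the tree's `berezin`: the coefficient of the top monomial) obeys
`|∫f DΨ| = |c_{univ}(f)| ≤ ‖f‖₁` outright — recorded for comparison with the printed route (457), which goes through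
`dμ_I` and pays `e^{|X|}`. [cite: Dimock2022UVStabilityQED3, §4.2.1 Lemma 20 proof (457) p.62 L31–38;
Dimock2002QED3TorusI, App. B (299) p.62 L9–13] -/
theorem norm_berezin_le_hNorm_one (F : GrassmannAlgebra 𝕜 ι) : ‖berezin 𝕜 ι F‖ ≤ hNorm 1 F := by
  have h1 : ‖berezin 𝕜 ι F‖ = (1:ℝ) ^ (Finset.univ : Finset ι).card * ‖coeff F Finset.univ‖ := by
    rw [one_pow, one_mul]; rfl
  rw [h1, hNorm_def]
  exact Finset.single_le_sum (f := fun S : Finset ι => (1:ℝ) ^ S.card * ‖coeff F S‖)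
    (fun S _ => mul_nonneg (pow_nonneg zero_le_one _) (norm_nonneg _)) (Finset.mem_univ _)

end UnitBound

/-! ## §2 `|∫f dμ_I| ≤ ‖f‖₁` for Dimock's unit Gaussian `dμ_I`, and `|∫e^{⟨Ψ̄,Ψ⟩}f dμ_I| ≤ e^{|X|}‖f‖₁` -/

section UnitGaussian

variable {X : Type*} [LinearOrder X] [Fintype X]

/-- **«`|∫f(Ψ)dμ_I(Ψ)| ≤ ‖f‖₁`» for Dimock's ACTUAL unit Gaussian** `dμ_I = gaussExpect 𝕜 (twoSpeciesCov 𝕜 1)`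
(`unitGaussian_hμ_twoSpeciesCov_one`: `|∫θ_T dμ_I| ≤ 1`, fed to §1).
[cite: Dimock2022UVStabilityQED3, §4.2.1 Lemma 20 proof (451)–(452) p.61 L30–47] -/
theorem norm_unitGaussExpect_le_hNorm_one (F : GrassmannAlgebra 𝕜 (X ⊕ₗ X)) :
    ‖gaussExpect 𝕜 (twoSpeciesCov 𝕜 (1 : Matrix X X 𝕜)) F‖ ≤ hNorm 1 F :=
  norm_apply_le_hNorm_one _ unitGaussian_hμ_twoSpeciesCov_one F

/-- `‖e^{⟨Ψ̄,Ψ⟩_X}‖₁ ≤ e^{|X|}`: LEMMA 19 of paper I on the powers (`hNormW_grassmannExp_le`) and `‖⟨Ψ̄,Ψ⟩_X‖₁ ≤ |X|`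
(`hNorm_one_quadratic_one_le`). [cite: Dimock2022UVStabilityQED3, §4.2.1 Lemma 20 proof (452) p.61 L59–67] -/
theorem hNorm_one_grassmannExp_quadratic_one_le :
    hNorm 1 (grassmannExp (quadratic 𝕜 (1 : Matrix X X 𝕜)) : GrassmannAlgebra 𝕜 (X ⊕ₗ X))
      ≤ Real.exp (Fintype.card X) := by
  have h := hNormW_grassmannExp_le (𝕜 := 𝕜) (w := fun _ : X ⊕ₗ X => (1:ℝ)) (fun _ => zero_le_one)
    (isNilpotent_quadratic 𝕜 (1 : Matrix X X 𝕜))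
  rw [hNormW_const, hNormW_const] at h
  exact h.trans (Real.exp_le_exp.mpr hNorm_one_quadratic_one_le)

/-- **`|∫e^{⟨Ψ̄,Ψ⟩_X}f dμ_I| ≤ e^{|X|}‖f‖₁`** — «estimated as a Gaussian integral which gives an additional factor
`e^{|Ω|}`»: §2's unit bound, `‖e^{Q}f‖₁ ≤ ‖e^{Q}‖₁‖f‖₁` (LEMMA 19) and `‖e^{Q}‖₁ ≤ e^{|X|}`.
[cite: Dimock2022UVStabilityQED3, §4.2.1 Lemma 20 proof (452) p.61 L53–67, (457) p.62 L31–38] -/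
theorem norm_unitGaussExpect_grassmannExp_quadratic_mul_le (F : GrassmannAlgebra 𝕜 (X ⊕ₗ X)) :
    ‖gaussExpect 𝕜 (twoSpeciesCov 𝕜 (1 : Matrix X X 𝕜)) (grassmannExp (quadratic 𝕜 1) * F)‖
      ≤ Real.exp (Fintype.card X) * hNorm 1 F := by
  refine (norm_unitGaussExpect_le_hNorm_one _).trans ((hNorm_mul_le zero_le_one _ _).trans ?_)
  exact mul_le_mul_of_nonneg_right hNorm_one_grassmannExp_quadratic_one_le (hNorm_nonneg zero_le_one _)

/-! ## §3 (457) PROVED, and LEMMA 20 (449) assembled with it -/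

/-- **(457)**: `|J_{K,Π}| = |∫F₀(Ψ₀)DΨ₀| ≤ e^{|δΩ₀^{(0)}|}‖F₀‖₁` — the product integral rewritten through Dimock's unit
Gaussian by (451) (`berezin_eq_det_mul_gaussExpect_unit`: `∫dΨ̄dΨ F = (−1)^{n(n−1)∕2}(−1)^n∫e^{⟨Ψ̄,Ψ⟩}F dμ_I`, the signs
have modulus `1`) and «estimated as a Gaussian integral which gives an additional factor `e^{|Ω|}`» (§2).
[cite: Dimock2022UVStabilityQED3, §4.2.1 Lemma 20 proof (451) p.61 L30–52, (457) p.62 L31–38] -/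
theorem eq457 (F : GrassmannAlgebra 𝕜 (X ⊕ₗ X)) :
    ‖berezin 𝕜 (X ⊕ₗ X) F‖ ≤ Real.exp (Fintype.card X) * hNorm 1 F := by
  rw [berezin_eq_det_mul_gaussExpect_unit (R := 𝕜) F, norm_mul, norm_mul, norm_pow, norm_pow, norm_neg, norm_one,
    one_pow, one_pow, one_mul, one_mul]
  exact norm_unitGaussExpect_grassmannExp_quadratic_mul_le F

/-- **LEMMA 20 (449) with (457) no longer a hypothesis**: for `J_{K,Π} = ∫F₀DΨ₀` (`F₀` on the `|X| = |δΩ₀^{(0)}|` sites left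
at the end), the iteration (456) `‖F₀‖₁ ≤ e^{S₁}a_K` and LEMMA 19's (435) `a_K ≤ e^{S₂}` give
`|J_{K,Π}| ≤ exp(|δΩ₀^{(0)}| + S₁ + S₂)` — `lemma20_assembled` fed with `eq457`.
[cite: Dimock2022UVStabilityQED3, §4.2.1 Lemma 20 (449) p.60 L96–107; proof (456)–(457) p.62 L31–38] -/
theorem lemma20_assembled_unit (F₀ : GrassmannAlgebra 𝕜 (X ⊕ₗ X)) {aK S₁ S₂ : ℝ}
    (h456 : hNorm 1 F₀ ≤ Real.exp S₁ * aK) (h435 : aK ≤ Real.exp S₂) :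
    ‖berezin 𝕜 (X ⊕ₗ X) F₀‖ ≤ Real.exp (Fintype.card X + S₁ + S₂) := by
  have h := lemma20_assembled (J := ‖berezin 𝕜 (X ⊕ₗ X) F₀‖) (by rw [abs_norm]; exact eq457 F₀) h456 h435
  rwa [abs_norm] at h

end UnitGaussian

/-! ## §4 LEMMA 20's integration step (452)∕(455) for `dμ_I` — no hypothesis on the measure -/

section Step

variable {ι₁ : Type*} [LinearOrder ι₁] [Fintype ι₁] {X : Type*} [LinearOrder X] [Fintype X]

/-- **The step (455), abstract kept block, for Dimock's `dμ_I`**: `lemma20_step` with `μ = ∫·dμ_I` on the integrated block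
`Ψ̄′,Ψ′` (labels `X ⊕ₗ X`) and its hypothesis `hμ` supplied by `unitGaussian_hμ_twoSpeciesCov_one`:
`‖L^{m}∫F(dΨ)e^{Q}dμ_I(Ψ′)‖_{w′} ≤ L^{m}e^{n}‖F‖_{(w_L,1)}`.
[cite: Dimock2022UVStabilityQED3, §4.2.1 Lemma 20 proof (451)–(452) p.61 L30–67, (455) p.62 L1–30] -/
theorem lemma20_step_unit {w w' wL : ι₁ → ℝ} (h0 : ∀ a, 0 ≤ w' a) (hle : ∀ a, w' a ≤ w a)
    (d : ι₁ ⊕ₗ (X ⊕ₗ X) → 𝕜)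
    (hd : ∀ ξ, ‖d ξ‖ * sumWeight w (fun _ => (1:ℝ)) ξ ≤ sumWeight wL (fun _ => (1:ℝ)) ξ)
    (F : GrassmannAlgebra 𝕜 (ι₁ ⊕ₗ (X ⊕ₗ X))) {Q : GrassmannAlgebra 𝕜 (X ⊕ₗ X)} (hQn : IsNilpotent Q) {n : ℝ}
    (hQ : hNormW (fun _ => (1:ℝ)) Q ≤ n) {L : ℝ} (hL : 0 ≤ L) (m : ℕ) :
    hNormW w' ((L ^ m : 𝕜) •
        partialExpect (gaussExpect 𝕜 (twoSpeciesCov 𝕜 (1 : Matrix X X 𝕜)))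
          (subst (Matrix.diagonal d) F * mapSnd (grassmannExp Q)))
      ≤ L ^ m * Real.exp n * hNormW (sumWeight wL fun _ => (1:ℝ)) F :=
  lemma20_step _ unitGaussian_hμ_twoSpeciesCov_one h0 hle d hd F hQn hQ hL m

/-- **The step (452)∕(455) as printed, for Dimock's `dμ_I`** — `lemma20_step_printed` with `μ = ∫·dμ_I =
gaussExpect 𝕜 (twoSpeciesCov 𝕜 1)` and NO hypothesis on the measure: integrating the block `Ψ′_{K,Ω_K}` against
`e^{⟨Ψ̄′,Ψ′⟩}dμ_I` after the scaling `Ψ = Ψ′_L` costs at most `e^{(1 + log L)|Ω_K^{(K)}|}` in the multiscale norm,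
`‖F_k‖_{w′} ≤ e^{(1+log L)|X|}‖F_{k+1}‖_{(Lw,1)}` (`0 ≤ w′ ≤ w`, `L > 0`).
[cite: Dimock2022UVStabilityQED3, §4.2.1 Lemma 20 proof (451)–(452) p.61 L30–67, (455) p.62 L1–30] -/
theorem lemma20_step_printed_unit {w w' : ι₁ → ℝ} (h0 : ∀ a, 0 ≤ w' a) (hle : ∀ a, w' a ≤ w a) {L : ℝ}
    (hL : 0 < L) (F : GrassmannAlgebra 𝕜 (ι₁ ⊕ₗ (X ⊕ₗ X))) :
    hNormW w' ((L ^ Fintype.card X : 𝕜) •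
        partialExpect (gaussExpect 𝕜 (twoSpeciesCov 𝕜 (1 : Matrix X X 𝕜)))
          (subst (Matrix.diagonal (printedScaling L)) F * mapSnd (grassmannExp (-(quadratic 𝕜 1)))))
      ≤ Real.exp ((1 + Real.log L) * Fintype.card X) * hNormW (sumWeight (fun a => L * w a) fun _ => (1:ℝ)) F :=
  lemma20_step_printed _ unitGaussian_hμ_twoSpeciesCov_one h0 hle hL F

end Step

end QED3LargeFieldFermion

end Literature.MathematicalPhysics.QuantumFieldTheory.Dimock2011to13

end
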